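import Summits.HodgeConjecture.HodgeConjecture.Theorems.F0LD1LineClassHasse
import Summits.HodgeConjecture.HodgeConjecture.Theorems.F0LD1ScalarFrameTransport
import Literature.NumberTheory.Automorphic.Liu2021.ThetaLiftFromLineSeamRescale
import HarnessLib

-- As in the lineage (★ `ThetaLiftFromLineSeamRescale`, ★ `F0LD1ScalarFrameTransport`): large statements over the theta-kernel datum; elaborate sequentially.
set_option Elab.async false

/-!
# Crux `HLiu418`, line LD1 (θ-road) — ORGAN (L-T⁺) `LineTransport₂` PAID FROM THE KITS: a STRONG meets of the theta lift from the line `⟨a″⟩`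
# transports to every line `⟨a₁⟩` locally isometric to it at all finite places with totally positive ratio (same frame `d_V`, SAME transport `ιA`)

Cell hodgecm-mathlib (D-0151), FLOOR 0; crux item `HLiu418` = stmt-HodgeConjecture-24832 (route `HCCMUnconditional`); half-A line LD1 (`stub_S1_facts` = #73
`Rogawski1990.curveThetaCohFinComponentUnique_hol`), θ-road leaf `Cruxes/HLiu418/Lines/F0_P6LD_StubS1FactsThetaRoad.lean` (LEAD «LD-R3′» PATH Y, 2026-09-02T05:11:42Z;
ED. 3 cand v9 a0057178fc3d8cba): its ONE in-house stub `stub_lineTransport₂ : LineTransport₂`, whose `def LineTransport₂` (:519) is the hypothesis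
`hLT` of ★ `F0LD1ThetaLinePinnedOfBricks.thetaLinePinned₂_of_bricks` (p849302 :118–:141) VERBATIM.  DEAL (LD1-plan (g0) 05:13:21Z, split): LD1-p02 (g2) =
the KIT ★ `Liu2021/ThetaLiftFromLineSeamRescale` (`MeetsThetaLiftFromLine.rescale`, p849539); LA1-p01 (g2) = THIS assembly over the kit and the two
bricks ★ `F0LD1LineClassHasse` (p849438) and ★ `F0LD1ScalarFrameTransport` (p849479).  THEOREMS ONLY (no `def`, no instance, no notation, no named fact,
no `sorry`); `--supports stmt-HodgeConjecture-24832`.  HC_CM is proved only modulo the 7 printed citations (2 remaining: hLiu418 = stmt-HodgeConjecture-24832,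
h413 = stmt-HodgeConjecture-24833) until rung 0 closes; this file discharges nothing printed (it pays an IN-HOUSE stub).

THE STATEMENT (`lineTransport₂_of_kits`, type = `hLT` ∕ `LineTransport₂` token for token): in the curve letters' frame (`L` CM, `[L:ℚ] ≥ 4`, scaled
rational frame `formCongr c̄ g (t • H) = diag dV` of signature `(1,1)` at `ι` and definite off `ι`, conjugate-symplectic `λ` of weight one, pinned
adelic transport `ιA`, `[U(diag dV)]` compact), for a discrete `P` of `U(H)` and units `a″, a₁` of `L⁺`: if `P` MEETS the theta lift from `⟨a″⟩` at `λ`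
along `ιA`, the classes of `a₁` and `a″` agree at every finite place (`locF L⁺ (imagUnitSq L) a₁ v = locF … a″ v`) and `a₁·a″⁻¹` is totally positive, then
`P` meets the theta lift from `⟨a₁⟩` at `λ` along the SAME `ιA`.

THE PROOF ([Liu2021, App. D §D.1 Step 1 footnote l. 5215: «the isomorphism class of `ω(μ, ε, χ)` depends only on `(μ, ε, χ)`»; proof of Cor. B.6 (3)
p. 99 L41–46]): (1) HASSE — `a₁·a″⁻¹ = e·ē` for some `e ∈ L^×` (★ `exists_eq_mul_complexConj_of_locF_eq_of_totallyPositive`, [Omeara1963, 65:23]);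
`c := ē e ∈ (L⁺)^×`, `c·a″ = a₁`; (2) FRAME — ★ `MeetsThetaLiftFromLine.frameTransport` at the scalar isometry `B = e·1`
(`ᵗ(c̄B)·(1•diag dV)·B = diag(c·dV)`, ★ `formCongr_smul_one`; majorants ★ `hasThetaMajorants_lineThetaKernelDatum₂`, compactness ★
`compactSpace_quotient_diagonal_of_posDef` at ★ `posDef_map_diagonal_smul_frame`): `Meets(dV, a″, ιA) ⇒ Meets(c·dV, a″, Ad(B⁻¹ ⊗ 1) ∘ ιA)`;
(3) RESCALE — ★ `MeetsThetaLiftFromLine.rescale` (LD1-p02 (g2)): `Meets(c·dV, a″, ι′) ⇒ Meets(dV, c·a″, θ_V ∘ ι′)`; (4) SAME TRANSPORT — `θ_V` and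
`Ad(B⁻¹ ⊗ 1)` are both the identity on matrices (★ `coe_frameRetype`, ★ `coe_adelicIsometryConj_aOfB_of_smul_one`: `B⁻¹ ⊗ 1` is a central scalar), so
`θ_V ∘ Ad(B⁻¹ ⊗ 1) ∘ ιA = ιA` (`MonoidHom.ext`); (5) `c·a″ = a₁`.

## References
* [Liu2021] Y. Liu, Camb. J. Math. 9 (2021) = arXiv:2102.11518: Def. 4.11–4.12 (l. 2088–2108); App. D §D.1 Step 1 footnote (l. 5215), Step 2 (l. 5219);
  App. B proof of Cor. B.6 (3) (p. 99).
* [Omeara1963] O. T. O'Meara, *Introduction to Quadratic Forms* (1963), §65D Thm. 65:23.  [MilneCM2006] J. S. Milne, *Complex Multiplication*, II §9 Lemma 9.14.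
* [Kudla1994] S. Kudla, Israel J. Math. 87 (1994), Thm. 3.1.  [Weil1964] A. Weil, Acta Math. 111 (1964), Chap. III n° 41 Thm 6.
* [PlatonovRapinchuk1994] V. Platonov, A. Rapinchuk, *Algebraic Groups and Number Theory* (1994), §2.3, §5.1.
-/

set_option autoImplicit false
-- the mandated namespace has the single-problem summit's repeated segment (`HodgeConjecture.HodgeConjecture`)
set_option linter.dupNamespace false

noncomputable section

open NumberField NumberField.InfinitePlace MeasureTheory IsDedekindDomain
open scoped Matrix ComplexOrder ENNReal Classical
open Literature.NumberTheory.Automorphic Literature.NumberTheory.Automorphic.UnitaryGroup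
open Literature.NumberTheory.Automorphic.IdeleClassGroup
open Literature.NumberTheory.Automorphic.Liu2021
open Literature.NumberTheory.Automorphic.Liu2021.Def411WeilCarriers
open Literature.NumberTheory.Automorphic.Liu2021.Def411WeilCarriersDoubling
open Literature.NumberTheory.GaloisRepresentations
open Literature.NumberTheory.GelbartRogawski1991 Literature.NumberTheory.GelbartRogawski1991.UnitaryDualPair
open Literature.NumberTheory.GelbartRogawski1991.GRConstruction
open Literature.NumberTheory.Weil1964
open Literature.RepresentationTheory.Liu2021 Literature.RepresentationTheory.HarrisKudlaSweet1996

namespace Summit.HodgeConjecture.HodgeConjecture.Cruxes.HLiu418.F0LD1LineTransportOfKits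

/-! ## §1 The scalar frame transport into the kit's frame convention `fun i => ↑↑c * dV i` -/

section Scalar

variable (L : Type) [Field L] [NumberField L] [IsCMField L] (ι : L →+* ℂ) (H : Matrix (Fin 2) (Fin 2) L)
  {n' : ℕ} (e₁ : Fin 2 × Fin 1 ≃ Fin n') (dV : Fin 2 → L) (hdV : ∀ i, IsCMField.complexConj L (dV i) = dV i) (hdV0 : ∀ i, dV i ≠ 0)
  (hdef : ∀ τ' : L →+* ℂ, InfinitePlace.mk τ' ≠ InfinitePlace.mk ι → ((Matrix.diagonal dV).map τ').PosDef)
  {μA : Measure (adelicGroupData (↥(maximalRealSubfield L)) L (IsCMField.complexConj L) 2 H).automorphicQuotient}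
  [(adelicGroupData (↥(maximalRealSubfield L)) L (IsCMField.complexConj L) 2 H).IsAutomorphicMeasure μA]
  (μ : Literature.NumberTheory.Automorphic.IdeleClassGroup L →ₜ* Circle) (hμ : IsConjugateSymplectic L μ) (a : (↥(maximalRealSubfield L))ˣ)
  (c : (↥(maximalRealSubfield L))ˣ) (e : L) (he : e ≠ 0) (hce : ((c : ↥(maximalRealSubfield L)) : L) = IsCMField.complexConj L e * e)

include hce in
/-- the kit's frame `fun i => ↑↑c * dV i` IS the rescaled frame `fun i => (ē e) * dV i` when `↑↑c = ē e`. [folklore] -/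
theorem frame_eq : (fun i => ((c : ↥(maximalRealSubfield L)) : L) * dV i) = fun i => (IsCMField.complexConj L e * e) * dV i :=
  funext fun i => by rw [hce]

include hce in
/-- the socket form `hB` of ★ `frameTransport` for `B = e·1`, in the kit's frame convention. [cite: PlatonovRapinchuk1994, §2.3] -/
theorem formCongr_scalarGL' :
    formCongr ((IsCMField.complexConj L : L ≃ₐ[Fp L] L) : L →+* L)
        (Units.map ((Matrix.scalar (Fin 2) : L →+* Matrix (Fin 2) (Fin 2) L) : L →* Matrix (Fin 2) (Fin 2) L) (Units.mk0 e he))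
        ((1 : L) • Matrix.diagonal dV) =
      Matrix.diagonal (fun i => ((c : ↥(maximalRealSubfield L)) : L) * dV i) := by
  rw [frame_eq L dV c e hce]
  exact F0LD1ScalarFrameTransport.formCongr_scalarGL L dV e he

include hdef he hce in
/-- the kit's rescaled frame is positive definite off `ι`. [cite: PlatonovRapinchuk1994, §5.3 Thm. 5.5] -/
theorem posDef_map_diagonal_frame (τ' : L →+* ℂ) (hτ' : InfinitePlace.mk τ' ≠ InfinitePlace.mk ι) :
    ((Matrix.diagonal fun i => ((c : ↥(maximalRealSubfield L)) : L) * dV i).map τ').PosDef := by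
  rw [frame_eq L dV c e hce]
  exact F0LD1ScalarFrameTransport.posDef_map_diagonal_smul_frame L ι dV e he hdef τ' hτ'

include ι hdef he hce in
/-- `[U(diag (c·dV))]` is compact. [cite: PlatonovRapinchuk1994, §5.3 Thm. 5.5] -/
theorem compactSpace_quotient_frame (h4 : 4 ≤ Module.finrank ℚ L) :
    CompactSpace (↥(UnitaryGroup.adelic (↥(maximalRealSubfield L)) L (IsCMField.complexConj L) 2
        (Matrix.diagonal fun i => ((c : ↥(maximalRealSubfield L)) : L) * dV i)) ⧸
      (UnitaryGroup.toAdelic (↥(maximalRealSubfield L)) L (IsCMField.complexConj L) 2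
        (Matrix.diagonal fun i => ((c : ↥(maximalRealSubfield L)) : L) * dV i)).range) :=
  F0LD2ArchAdmissibleAssembly.compactSpace_quotient_diagonal_of_posDef L 2 _ ι (posDef_map_diagonal_frame L ι dV hdef c e he hce) h4

include hdef hce in
/-- **THE SCALAR FRAME TRANSPORT in the kit's convention**: `Meets(dV, a, ιA) ⇒ Meets(c·dV, a, Ad((e·1)⁻¹ ⊗ 1) ∘ ιA)` for `↑↑c = ē e` (★
`MeetsThetaLiftFromLine.frameTransport` at `B = e·1`, majorants ★ `hasThetaMajorants_lineThetaKernelDatum₂` of the rescaled frame).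
[cite: Liu2021, App. D §D.1 Step 1 footnote (l. 5215), Step 2 (l. 5219)] [cite: Kudla1994, Thm. 3.1] -/
theorem meets_frameTransport_scalar
    [CompactSpace (↥(UnitaryGroup.adelic (↥(maximalRealSubfield L)) L (IsCMField.complexConj L) 2 (Matrix.diagonal dV)) ⧸
      (UnitaryGroup.toAdelic (↥(maximalRealSubfield L)) L (IsCMField.complexConj L) 2 (Matrix.diagonal dV)).range)]
    [CompactSpace (↥(UnitaryGroup.adelic (↥(maximalRealSubfield L)) L (IsCMField.complexConj L) 2
        (Matrix.diagonal fun i => ((c : ↥(maximalRealSubfield L)) : L) * dV i)) ⧸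
      (UnitaryGroup.toAdelic (↥(maximalRealSubfield L)) L (IsCMField.complexConj L) 2
        (Matrix.diagonal fun i => ((c : ↥(maximalRealSubfield L)) : L) * dV i)).range)]
    (P : DiscreteAutomorphicRep (adelicGroupData (↥(maximalRealSubfield L)) L (IsCMField.complexConj L) 2 H) μA)
    (ιA : (adelicGroupData (↥(maximalRealSubfield L)) L (IsCMField.complexConj L) 2 H).Adelic →*
      ↥(UnitaryGroup.adelic (↥(maximalRealSubfield L)) L (IsCMField.complexConj L) 2 (Matrix.diagonal dV)))
    (h : MeetsThetaLiftFromLine L 2 H e₁ dV hdV hdV0 P μ hμ a ιA) :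
    MeetsThetaLiftFromLine L 2 H e₁ (fun i => ((c : ↥(maximalRealSubfield L)) : L) * dV i)
      (Def411WeilCarriersDoubling.complexConj_smul_frame L dV c hdV) (Def411WeilCarriersDoubling.smul_frame_ne_zero L dV c hdV0) P μ hμ a
      ((adelicIsometryConj (Fp L) L (IsCMField.complexConj L) 2
          (aOfB L (Units.map ((Matrix.scalar (Fin 2) : L →+* Matrix (Fin 2) (Fin 2) L) : L →* Matrix (Fin 2) (Fin 2) L) (Units.mk0 e he)))
          (aOfB_isometry L (fun i => ((c : ↥(maximalRealSubfield L)) : L) * dV i) dV _ (formCongr_scalarGL' L dV c e he hce))).comp ιA) :=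
  MeetsThetaLiftFromLine.frameTransport L 2 H e₁ dV hdV hdV0 (fun i => ((c : ↥(maximalRealSubfield L)) : L) * dV i)
    (Def411WeilCarriersDoubling.complexConj_smul_frame L dV c hdV) (Def411WeilCarriersDoubling.smul_frame_ne_zero L dV c hdV0) μ hμ a _
    (formCongr_scalarGL' L dV c e he hce)
    (F0LD1ScalarFrameTransport.hasThetaMajorants_lineThetaKernelDatum₂ L ι e₁ _
      (Def411WeilCarriersDoubling.complexConj_smul_frame L dV c hdV) (Def411WeilCarriersDoubling.smul_frame_ne_zero L dV c hdV0)
      (posDef_map_diagonal_frame L ι dV hdef c e he hce) μ hμ a) P ιA h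

end Scalar

/-! ## §2 The organ (L-T⁺): `hLT` ∕ `LineTransport₂` token for token -/

set_option maxHeartbeats 1600000 in
-- (the organ's binder list and the two seam telescopes are large; every step is a named ★ lemma)
/-- **ORGAN (L-T⁺) `LineTransport₂` — LINE TRANSPORT OF A STRONG MEETS along locally-isometric, totally-positive-ratio lines** (type = the hypothesis
`hLT` of ★ `F0LD1ThetaLinePinnedOfBricks.thetaLinePinned₂_of_bricks` = LD1 leaf ED. 3 `def LineTransport₂`, VERBATIM): Hasse (★ `F0LD1LineClassHasse`)
→ scalar frame transport (§1 over ★ `frameTransport`) → ★ `MeetsThetaLiftFromLine.rescale` → the composite transport is `ιA` (both retypings are the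
identity on matrices) → `c·a″ = a₁`. [cite: Liu2021, App. D §D.1 Step 1 footnote (l. 5215); App. B proof of Cor. B.6 (3) (p. 99)]
[cite: Omeara1963, §65D Thm. 65:23] [cite: Kudla1994, Thm. 3.1] [cite: PlatonovRapinchuk1994, §2.3, §5.1] -/
theorem lineTransport₂_of_kits :
  ∀ (L : Type) [Field L] [NumberField L] [IsCMField L] (ι : L →+* ℂ) (H : Matrix (Fin 2) (Fin 2) L)
      (dV : Fin 2 → L) (hdV : ∀ i, IsCMField.complexConj L (dV i) = dV i) (hdV0 : ∀ i, dV i ≠ 0)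
      (t : L) (ht : t ≠ 0) (g : GL (Fin 2) L)
      (hg : formCongr ((IsCMField.complexConj L : L ≃ₐ[↥(maximalRealSubfield L)] L) : L →+* L) g (t • H) = Matrix.diagonal dV),
      (∃ T : GL (Fin 2) ℂ, formCongr (starRingEnd ℂ) T ((Matrix.diagonal dV).map ι) = Matrix.diagonal ![(1 : ℂ), -1]) →
      (∀ τ' : L →+* ℂ, InfinitePlace.mk τ' ≠ InfinitePlace.mk ι → ((Matrix.diagonal dV).map τ').PosDef) →
      4 ≤ Module.finrank ℚ L →
      ∀ (μ : Measure (adelicGroupData (↥(maximalRealSubfield L)) L (IsCMField.complexConj L) 2 H).automorphicQuotient)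
        [(adelicGroupData (↥(maximalRealSubfield L)) L (IsCMField.complexConj L) 2 H).IsAutomorphicMeasure μ]
        {n' : ℕ} (e₁ : Fin 2 × Fin 1 ≃ Fin n')
        (lam : Literature.NumberTheory.Automorphic.IdeleClassGroup L →ₜ* Circle) (hlam : IsConjugateSymplectic L lam), HasWeight L lam 1 →
      ∀ (ιA : (adelicGroupData (↥(maximalRealSubfield L)) L (IsCMField.complexConj L) 2 H).Adelic →*
          ↥(UnitaryGroup.adelic (↥(maximalRealSubfield L)) L (IsCMField.complexConj L) 2 (Matrix.diagonal dV))),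
        (∀ k, ((ιA k : ↥(UnitaryGroup.adelic (↥(maximalRealSubfield L)) L (IsCMField.complexConj L) 2 (Matrix.diagonal dV))) :
              GL (Fin 2) (AdeleRing (𝓞 L) L)) =
            (toAdeleGL L g)⁻¹ * adelicVal (↥(maximalRealSubfield L)) L (IsCMField.complexConj L) 2 H k * toAdeleGL L g) →
      ∀ [CompactSpace (↥(UnitaryGroup.adelic (↥(maximalRealSubfield L)) L (IsCMField.complexConj L) 2 (Matrix.diagonal dV)) ⧸
          (UnitaryGroup.toAdelic (↥(maximalRealSubfield L)) L (IsCMField.complexConj L) 2 (Matrix.diagonal dV)).range)],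
      ∀ (P : DiscreteAutomorphicRep (adelicGroupData (↥(maximalRealSubfield L)) L (IsCMField.complexConj L) 2 H) μ) (a'' a₁ : (↥(maximalRealSubfield L))ˣ),
        MeetsThetaLiftFromLine L 2 H e₁ dV hdV hdV0 P lam hlam a'' ιA →
        (∀ v : HeightOneSpectrum (𝓞 (↥(maximalRealSubfield L))),
          locF (↥(maximalRealSubfield L)) (imagUnitSq L) a₁ v = locF (↥(maximalRealSubfield L)) (imagUnitSq L) a'' v) →
        (∀ ρ : (↥(maximalRealSubfield L)) →+* ℝ, 0 < ρ ((a₁ : (↥(maximalRealSubfield L))) * ((a'' : (↥(maximalRealSubfield L))))⁻¹)) →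
        MeetsThetaLiftFromLine L 2 H e₁ dV hdV hdV0 P lam hlam a₁ ιA := by
  intro L _ _ _ ι H dV hdV hdV0 t ht g hg _hsig hdef h4 μA _ n' e₁ lam hlam _hw ιA _hpin _ P a'' a₁ hmeet hloc hpos
  -- (1) HASSE: `a₁ · a″⁻¹ = e · ē`
  obtain ⟨e, he⟩ := F0LD1LineClassHasse.exists_eq_mul_complexConj_of_locF_eq_of_totallyPositive L a₁ a'' hloc hpos
  have hb0 : (a₁ : ↥(maximalRealSubfield L)) * ((a'' : ↥(maximalRealSubfield L)))⁻¹ ≠ 0 :=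
    mul_ne_zero a₁.ne_zero (inv_ne_zero a''.ne_zero)
  have he0 : e ≠ 0 := F0LD1LineClassHasse.ne_zero_of_eq_mul_complexConj L hb0 he
  -- the scale `c := ē e ∈ (L⁺)^×`, with `c · a″ = a₁`
  have hmem : IsCMField.complexConj L e * e ∈ maximalRealSubfield L :=
    (IsCMField.complexConj_eq_self_iff (K := L) _).1 (by rw [map_mul, IsCMField.complexConj_apply_apply, mul_comm])
  have hne : (⟨IsCMField.complexConj L e * e, hmem⟩ : ↥(maximalRealSubfield L)) ≠ 0 := fun h0 =>
    mul_ne_zero ((map_ne_zero _).2 he0) he0 (congrArg Subtype.val h0)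
  have hce : (((Units.mk0 (⟨IsCMField.complexConj L e * e, hmem⟩ : ↥(maximalRealSubfield L)) hne : (↥(maximalRealSubfield L))ˣ) :
      ↥(maximalRealSubfield L)) : L) = IsCMField.complexConj L e * e := rfl
  have hca : Units.mk0 (⟨IsCMField.complexConj L e * e, hmem⟩ : ↥(maximalRealSubfield L)) hne * a'' = a₁ := by
    apply Units.ext
    apply (algebraMap (↥(maximalRealSubfield L)) L).injective
    rw [Units.val_mul, map_mul, Units.val_mk0, show algebraMap (↥(maximalRealSubfield L)) L ⟨IsCMField.complexConj L e * e, hmem⟩ =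
      IsCMField.complexConj L e * e from rfl, mul_comm (IsCMField.complexConj L e) e, ← he, ← map_mul,
      inv_mul_cancel_right₀ a''.ne_zero]
  -- (2) FRAME: the scalar frame transport into `diag (c · dV)`
  haveI := compactSpace_quotient_frame L ι dV hdef _ e he0 hce h4
  have h1 := meets_frameTransport_scalar L ι H e₁ dV hdV hdV0 hdef lam hlam a'' _ e he0 hce P ιA hmeet
  -- (3) RESCALE: back to `diag dV` on the line `⟨c · a″⟩`
  have h2 := MeetsThetaLiftFromLine.rescale L 2 H e₁ dV hdV hdV0 lam hlam _ a''
    (F0LD1ScalarFrameTransport.hasThetaMajorants_lineThetaKernelDatum₂ L ι e₁ dV hdV hdV0 hdef lam hlam _) P _ h1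
  -- (4) SAME TRANSPORT: both retypings are the identity on matrices
  have hι : (MulEquiv.subgroupCongr (Def411WeilCarriersDoubling.adelic_diagonal_smul_frame L dV
        (Units.mk0 (⟨IsCMField.complexConj L e * e, hmem⟩ : ↥(maximalRealSubfield L)) hne))).toMonoidHom.comp
      ((adelicIsometryConj (Fp L) L (IsCMField.complexConj L) 2
          (aOfB L (Units.map ((Matrix.scalar (Fin 2) : L →+* Matrix (Fin 2) (Fin 2) L) : L →* Matrix (Fin 2) (Fin 2) L) (Units.mk0 e he0)))
          (aOfB_isometry L _ dV _ (formCongr_scalarGL' L dV _ e he0 hce))).comp ιA) = ιA := by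
    refine MonoidHom.ext fun k => Subtype.ext (Units.ext ?_)
    rw [MonoidHom.comp_apply, MonoidHom.comp_apply, MulEquiv.coe_toMonoidHom, Def411WeilCarriersDoubling.coe_frameRetype,
      F0LD1ScalarFrameTransport.coe_adelicIsometryConj_aOfB_of_smul_one L e _ (F0LD1ScalarFrameTransport.coe_scalarGL L e he0)
        (F0LD1ScalarFrameTransport.coe_scalarGL_inv L e he0) _ he0]
  rw [hι, hca] at h2
  exact h2

end Summit.HodgeConjecture.HodgeConjecture.Cruxes.HLiu418.F0LD1LineTransportOfKits

end
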